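import Mathlib
import HarnessLib
import Summits.ValiantsHypothesis.ValiantsHypothesis.Theorems.MonotoneRestorationOrbitRestorationQPColUntwistedMain
import Summits.ValiantsHypothesis.ValiantsHypothesis.Theorems.MonotoneRestorationOrbitRestorationQPLocalFactors

/-!
# Matrix-symmetric products of column-local affine forms are narrow — self-contained form (SPAN currency)

Route MonotoneRestoration, crux `OrbitRestorationQP` (stmt-ValiantsHypothesis-18293), SPAN-currency lane of the open
sub-rung A_∞ (`stub_sigmaPiSigmaValue`), `ΠΣ` part.  Helper (`--supports`), def-free.  The supports are obtained
internally from the route's structure theorem `LocalFactors.exists_rowColSupports_of_matrixSymmetric`, so the statement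
has exactly the hypotheses of the squares theorem `NormalisedFactors.sq_mem_narrowSpan_of_matrixSymmetric` plus ONE
intrinsic locality hypothesis, and NO twist hypothesis:

* **`prod_mem_narrowSpan_of_colLocalOne_matrixSymmetric`** — let `f = C a · Π_i L_i ≠ 0` (`|ι| < C(n,k)` factors of
  total degree `≤ 1`, `8 < n`, `1 ≤ k`, `4k ≤ n`) be invariant under all row and all column renamings, and suppose every
  factor is fixed by the column renamings fixing ONE column (the factor's own; rows unrestricted — e.g. every factor is
  an affine form in `x_{aq} (a < n), R_a (a < n), C_q, U` for its column `q`).  Then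
  `f ∈ span_ℂ {hom_{F,n} : tw F ≤ 3}` — polynomial orbits in span currency, whatever the row sign characters of its
  blocks (the column Vandermondes `W_n`, `n` even, and all their affine generalisations are instances).
  Proof: the delivered column supports are `Stab(q)`-stable of size `< k ≤ n/4`, hence `⊆ {q}`;
  then `SuperAtoms.prod_mem_narrowSpan_of_colSupportLeOne_supports` (pairing theorem + even Newton).

No registered stub is closed; the crux and VP ≠ VNP are not moved. [folklore; cite: DwivediPagoSeppelt2026, §8;
DixonMortimer1996, Thm 5.2B]
-/

noncomputable section

open scoped Pointwise

-- `Summit.ValiantsHypothesis.ValiantsHypothesis.…` is the tree's single-conjunct layout (Sub = Summit).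
set_option linter.dupNamespace false

namespace Summit.ValiantsHypothesis.ValiantsHypothesis.Theorems

namespace SuperAtoms

open MvPolynomial Finset Equiv ProductAction
open Literature.Computability.AlgebraicComplexity (homPoly)
open Literature.Combinatorics.SimpleGraph (treewidth)

variable {n : ℕ}

/-- **A `Stab(q)`-stable small set of columns is `⊆ {q}`.** [folklore] -/
theorem subset_singleton_of_stab_smul {k : ℕ} (hkn : k + 2 ≤ n) (q : Fin n) (A : Finset (Fin n)) (hA : A.card < k)
    (hstab : ∀ τ : Perm (Fin n), τ q = q → τ • A = A) : A ⊆ {q} := by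
  classical
  intro x hx
  rw [Finset.mem_singleton]
  by_contra hxq
  have hall : (univ : Finset (Fin n)).erase q ⊆ A := by
    intro y hy
    have hyq : y ≠ q := (Finset.mem_erase.1 hy).1
    by_cases hyx : y = x
    · rw [hyx]; exact hx
    · have hτ := hstab (swap x y) (swap_apply_of_ne_of_ne (Ne.symm hxq) (Ne.symm hyq))
      have : swap x y • x ∈ swap x y • A := Finset.smul_mem_smul_finset hx
      rw [hτ, Perm.smul_def, swap_apply_left] at this
      exact this
  have hcard := Finset.card_le_card hall
  rw [Finset.card_erase_of_mem (Finset.mem_univ q), Finset.card_univ, Fintype.card_fin] at hcard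
  omega

/-- **MATRIX-SYMMETRIC PRODUCTS OF COLUMN-LOCAL AFFINE FORMS HAVE POLYNOMIAL ORBITS (span currency, self-contained).**
[folklore; cite: DwivediPagoSeppelt2026, §8; DixonMortimer1996, Thm 5.2B] -/
theorem prod_mem_narrowSpan_of_colLocalOne_matrixSymmetric {k : ℕ} (hn : 8 < n) (hk : 1 ≤ k) (h4k : 4 * k ≤ n)
    {ι : Type} [Fintype ι] (L : ι → MvPolynomial (Fin n × Fin n) ℂ) (a : ℂ)
    (hL : ∀ i, (L i).totalDegree ≤ 1) (hcard : Fintype.card ι < n.choose k) (hf0 : C a * ∏ i, L i ≠ 0)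
    (hrow : ∀ σ : Perm (Fin n), vact (K := ℂ) rowHom σ (C a * ∏ i, L i) = C a * ∏ i, L i)
    (hcol : ∀ τ : Perm (Fin n), vact (K := ℂ) colHom τ (C a * ∏ i, L i) = C a * ∏ i, L i)
    (h1 : ∀ i, ∃ q : Fin n, ∀ ρ : Perm (Fin n), ρ q = q → vact (K := ℂ) colHom ρ (L i) = L i) :
    (C a * ∏ i, L i) ∈ Submodule.span ℂ {p : MvPolynomial (Fin n × Fin n) ℂ |
        ∃ (a b : ℕ) (E : Multiset (Fin a × Fin b)),
          treewidth (SimpleGraph.fromRel fun u v : Fin a ⊕ Fin b =>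
            ∃ e ∈ E, u = Sum.inl e.1 ∧ v = Sum.inr e.2) ≤ 3 ∧ p = homPoly E n ℂ} := by
  classical
  -- split off the constant factors
  set P : ι → Prop := fun i => (L i).totalDegree = 1 with hP
  have hconst : ∀ i, ¬ P i → L i = C (constantCoeff (L i)) := by
    intro i hi
    have h0 : (L i).totalDegree = 0 := by have := hL i; simp only [hP] at hi; omega
    rw [constantCoeff_eq]
    exact (totalDegree_eq_zero_iff_eq_C (p := L i)).1 h0
  set ι₁ := {i // P i} with hι₁
  set L₁ : ι₁ → MvPolynomial (Fin n × Fin n) ℂ := fun i => L i with hL₁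
  set b : ℂ := ∏ i : {i // ¬ P i}, constantCoeff (L i) with hb
  have hsplit : C a * ∏ i, L i = C (a * b) * ∏ i : ι₁, L₁ i := by
    rw [← Fintype.prod_subtype_mul_prod_subtype P L, hb, map_mul, map_prod]
    have hc : (∏ i : {i // ¬ P i}, L (i : ι)) = ∏ i : {i // ¬ P i}, C (constantCoeff (L (i : ι))) :=
      Finset.prod_congr rfl fun i _ => hconst i i.2
    rw [hc]
    ring
  have hL₁1 : ∀ i : ι₁, (L₁ i).totalDegree = 1 := fun i => i.2
  have hf0₁ : C (a * b) * ∏ i : ι₁, L₁ i ≠ 0 := by rwa [← hsplit]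
  have hrow₁ : ∀ σ : Perm (Fin n), vact (K := ℂ) rowHom σ (C (a * b) * ∏ i : ι₁, L₁ i) = C (a * b) * ∏ i : ι₁, L₁ i := by
    intro σ; rw [← hsplit]; exact hrow σ
  have hcol₁ : ∀ τ : Perm (Fin n), vact (K := ℂ) colHom τ (C (a * b) * ∏ i : ι₁, L₁ i) = C (a * b) * ∏ i : ι₁, L₁ i := by
    intro τ; rw [← hsplit]; exact hcol τ
  have hfix₁ : ∀ σ τ : Perm (Fin n),
      rename (fun Q : Fin n × Fin n => (σ Q.1, τ Q.2)) (C (a * b) * ∏ i : ι₁, L₁ i) = C (a * b) * ∏ i : ι₁, L₁ i := by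
    intro σ τ
    rw [rename_prod_eq, hcol₁ τ, hrow₁ σ]
  -- the supports from the structure theorem (multiset form)
  set M : Multiset (MvPolynomial (Fin n × Fin n) ℂ) := (univ : Finset ι₁).val.map L₁ with hM
  have hMprod : C (a * b) * M.prod = C (a * b) * ∏ i : ι₁, L₁ i := by rw [hM, Finset.prod_eq_multiset_prod]
  have hML : ∀ ℓ ∈ M, ℓ.totalDegree ≤ 1 := by
    intro ℓ hℓ
    rw [hM, Multiset.mem_map] at hℓ
    obtain ⟨i, -, rfl⟩ := hℓ
    exact (hL₁1 i).le
  have hMcard : Multiset.card M < n.choose k := by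
    rw [hM, Multiset.card_map, Finset.card_val, Finset.card_univ]
    exact (Fintype.card_subtype_le P).trans_lt hcard
  have hMf0 : C (a * b) * M.prod ≠ 0 := by rwa [hMprod]
  have hMrow : ∀ σ : Perm (Fin n), vact (K := ℂ) rowHom σ (C (a * b) * M.prod) = C (a * b) * M.prod := by
    intro σ; rw [hMprod]; exact hrow₁ σ
  have hMcol : ∀ τ : Perm (Fin n), vact (K := ℂ) colHom τ (C (a * b) * M.prod) = C (a * b) * M.prod := by
    intro τ; rw [hMprod]; exact hcol₁ τ
  obtain ⟨R, S, -, S1, -, -, S2, S3, -, -, hfac⟩ :=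
    LocalFactors.exists_rowColSupports_of_matrixSymmetric (K := ℂ) hn hk h4k hML hMcard hMf0 hMrow hMcol
  have hmem : ∀ i : ι₁, L₁ i ∈ M := fun i => by
    rw [hM]; exact Multiset.mem_map_of_mem _ (Finset.mem_univ_val i)
  -- the delivered column supports are `Stab(q)`-stable, hence `⊆ {q}`
  have hS1 : ∀ i : ι₁, (S (L₁ i)).card ≤ 1 := by
    intro i
    obtain ⟨q, hq⟩ := h1 (i : ι)
    have hsub : S (L₁ i) ⊆ {q} := by
      refine subset_singleton_of_stab_smul (k := k) (by omega) q (S (L₁ i)) (hfac (L₁ i) (hmem i)).2.1 fun τ hτ => ?_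
      rw [← S2, hq τ hτ]
    exact (Finset.card_le_card hsub).trans (by rw [Finset.card_singleton])
  have h := prod_mem_narrowSpan_of_colSupportLeOne_supports (by omega) L₁ (a * b) hL₁1 hf0₁ hfix₁ S S1 S2 S3 hS1
    (fun i ρ hρ => (hfac (L₁ i) (hmem i)).2.2.2.1 ρ hρ)
  rwa [← hsplit] at h

end SuperAtoms

end Summit.ValiantsHypothesis.ValiantsHypothesis.Theorems

end
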